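import Summits.BirchSwinnertonDyer.Uniform.U2.GenusTheoryEndToEndInertPlacewise
import HarnessLib

/-!
# Cell «bsd-uniform», track U2, route C — the SPLIT step of the ring class tower inside `Gal(K[n]/K)`:
# Darmon's one-step shape `a·z − G₁ z − G₂ z` transported and folded (residue R2-11, split primes)

HONEST FRAMING (cell «bsd-uniform», run/shared/lean/pub/bsd-uniform/, seat u2-p1): pure bookkeeping
THEOREMS about traces of points along the tower `K ⊂ K[M] ⊂ K[m'] ⊂ K[n]` read inside the one group
`G = Gal(K[n]/K)`; no claim about BSD, nothing booked, no census number moved, no per-curve certificate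
counted as uniform. Route C's composed trace relation `htr : Σ_{σ ∈ Gal(K[|d|]/K)} σ·y = m₀·y_K` (`m₀`
odd) — the hypothesis of every U2 end-to-end head off the inert family — was a KERNEL THEOREM only when
every prime of `d` is INERT in `K` (`GenusPointRingClassSquarefree.lean`, p503242; HOME/RESIDUE.md
R2-11). For a SPLIT prime `ℓ = λλ̄` the one-step relation is Darmon 2004 Prop. 3.10 (2),
`Tr_{K[Mℓ]/K[M]} y_{Mℓ} = a_ℓ·y_M − σ_λ y_M − σ_λ̄ y_M`, now a Literature THEOREM in its Hecke-half shape
with `σ_λ, σ_λ̄` replaced by SOME `G₁, G₂ ∈ Gal(K[Mℓ]/K)` (ue-lit g15,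
`Darmon2004.exists_finsum_pointGalHom_eq_frobeniusTrace_smul_sub_sub_of_split`, p530045; the
reciprocity `Gᵢ = σ_λ^{±1}` stays open and is NOT needed here). For the trace down to `K` the
unknown `Gᵢ` are harmless: `G` is abelian (Gross 1991 §3; tree `isMulCommutative_ringClassGal'`), so
`Σ_c c̃ (Gᵢ z) = Gᵢ (Σ_c c̃ z) = Gᵢ (m·y_K) = m·y_K` (`K`-points are fixed), and the level folds with
multiplier `a_ℓ − 2` — ODD iff `a_ℓ` is. This file supplies the three bookkeeping pieces; the
induction and the heads are `GenusPointRingClassUnramified.lean` / `GenusTheoryEndToEndCLTZPlacewise.lean`.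

## Contents (theorems only; no `def`, no named fact)
* `exists_restrictGal_eq_of_mem_ringClassGal` — every `τ ∈ Gal(K[m']/K)` lifts to `Gal(K[n]/K)`.
* `exists_sum_quotient_pointGalHom_eq_sub_sub_of_step` — transport of the split one-step relation
  `E(K[m']) → E(K[n])` over `Gal(K[n]/K[M]) / Gal(K[n]/K[m'])`, with lifted `Γ₁, Γ₂ ∈ Gal(K[n]/K)`.
* `sum_quotient_eq_sub_two_mul_smul_of_split_step` — the SPLIT fold: lower levels `m·y_K` and the
  split one-step give `((a − 2)·m)·y_K`.
* `sum_quotient_eq_mul_smul_of_inert_step` — the INERT fold in the same currency: `(a·m)·y_K`.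

References: Darmon 2004 Prop. 3.10 [Darmon2004]; Gross 1991 §3–§4 [GrossLMS1991]; Coates–Li–Tian–Zhai
2015 Lemma 2.9 [CoatesLiTianZhai2015]; T4-PROOF.md v1.9b §3 L2′ (HOME).
-/

noncomputable section

open scoped Classical

open WeierstrassCurve NumberField Literature.NumberTheory.EllipticCurves
  Literature.NumberTheory.EllipticCurves.ModularForms Summit.BirchSwinnertonDyer.Rank1Residual.X11b

set_option autoImplicit false

namespace Summit.BirchSwinnertonDyer.Uniform.U2.RingClass

variable {K : Type} [Field K] [NumberField K] (ι : K →+* ℂ) (hK : IsImaginaryQuadratic K)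
  {m' n : ℕ} (hm'n : m' ∣ n) (hn : n ≠ 0)

/-! ## §1 Lifting an arbitrary element of `Gal(K[m']/K)` to `Gal(K[n]/K)` -/

/-- **Lifting**: every `τ ∈ Gal(K[m']/K)` (`m' ∣ n`) is the restriction of some `σ ∈ Gal(K[n]/K)`
(Mathlib `AlgEquiv.liftNormal` along the normal extension `K[n]/K`; the tree's `exists_restrictGal_eq`
is the same statement for `τ ∈ Gal(K[m']/K[m])` with the extra bookkeeping `σ ∈ Gal(K[n]/K[m])`).
[folklore] -/
theorem exists_restrictGal_eq_of_mem_ringClassGal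
    (τ : ringClassField K ι m' ≃ₐ[ℚ] ringClassField K ι m') (hτK : τ ∈ ringClassGal ι m') :
    ∃ σ : ringClassGal ι n, (restrictGal ι hK hm'n hn σ).1 = τ := by
  have hm' : m' ≠ 0 := ne_zero_of_dvd hm'n hn
  have hle : ringClassField K ι m' ≤ ringClassField K ι n := ringClassField_mono hK ι hm'n hn
  letI : Algebra (ringClassField K ι m') (ringClassField K ι n) :=
    (RingClassField.inclusion ι hle).toRingHom.toAlgebra
  haveI : IsScalarTower K (ringClassField K ι m') (ringClassField K ι n) :=
    IsScalarTower.of_algebraMap_eq fun k => ((RingClassField.inclusion ι hle).commutes k).symm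
  haveI := (finiteDimensional_and_isGalois_ringClassField hK ι hn).2
  haveI := (finiteDimensional_and_isGalois_ringClassField hK ι hm').2
  set τK : ringClassField K ι m' ≃ₐ[K] ringClassField K ι m' := algEquivOfMem ι m' ⟨τ, hτK⟩
    with hτK_def
  set σK : ringClassField K ι n ≃ₐ[K] ringClassField K ι n := τK.liftNormal (ringClassField K ι n)
    with hσK_def
  have hkey : ∀ x' : ringClassField K ι m',
      ((σK (RingClassField.inclusion ι hle x') : ringClassField K ι n) : ℂ) = ((τ x' : _) : ℂ) := by
    intro x'
    have h := AlgEquiv.liftNormal_commutes τK (ringClassField K ι n) x'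
    have h' := congrArg (fun z : ringClassField K ι n => (z : ℂ)) h
    rw [show (algebraMap (ringClassField K ι m') (ringClassField K ι n)) =
        (RingClassField.inclusion ι hle).toRingHom from rfl, AlgHom.toRingHom_eq_coe,
      AlgHom.coe_toRingHom, RingClassField.coe_inclusion] at h'
    exact h'
  refine ⟨⟨σK.restrictScalars ℚ, restrictScalars_mem_ringClassGal ι n σK⟩, ?_⟩
  apply AlgEquiv.ext
  intro x'
  apply Subtype.ext
  rw [coe_restrictGal_apply]
  exact hkey x'

/-! ## §2 The split one-step relation transported into `E(K[n])` -/

/-- **TRANSPORT OF A SPLIT ONE-STEP RELATION `E(K[m']) → E(K[n])`** (`M ∣ m' ∣ n`). With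
`G = Gal(K[n]/K)`, `H_M = Gal(K[n]/K[M])`, `H = Gal(K[n]/K[m'])` (as subgroups of `G`): a relation at
the top field `K[m']` of the shape of Darmon 2004 Prop. 3.10 (2),
`Σ_{τ ∈ Gal(K[m']/K[M])} τ·y = a·z' − G₁ z' − G₂ z'` (`z' = incl_{M→m'} z`, `G₁, G₂ ∈ Gal(K[m']/K)`),
becomes in `E(K[n])` the relative-trace relation
`Σ_{e ∈ H_M/H} ẽ · incl_{m'→n}(y) = a · incl_{M→n}(z) − Γ₁ incl_{M→n}(z) − Γ₂ incl_{M→n}(z)` for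
lifts `Γᵢ ∈ G` of `Gᵢ`. [cite: Darmon2004, Prop. 3.10 (the shape of case (2))] -/
theorem exists_sum_quotient_pointGalHom_eq_sub_sub_of_step {M : ℕ} (hMm' : M ∣ m')
    (W : WeierstrassCurve ℚ)
    [Fintype (((ringClassGalOver ι n M).subgroupOf (ringClassGal ι n)) ⧸
      (((ringClassGalOver ι n m').subgroupOf (ringClassGal ι n)).subgroupOf
        ((ringClassGalOver ι n M).subgroupOf (ringClassGal ι n))))]
    [Fintype (ringClassGalOver ι m' M)]
    (y : (W.baseChange (ringClassField K ι m' : Type)).toAffine.Point)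
    (z : (W.baseChange (ringClassField K ι M : Type)).toAffine.Point) (a : ℤ)
    (G₁ G₂ : ringClassField K ι m' ≃ₐ[ℚ] ringClassField K ι m')
    (hG₁ : G₁ ∈ ringClassGal ι m') (hG₂ : G₂ ∈ ringClassGal ι m')
    (hstep : ∑ᶠ τ ∈ (ringClassGalOver ι m' M :
        Set (ringClassField K ι m' ≃ₐ[ℚ] ringClassField K ι m')),
        pointGalHom W (ringClassField K ι m') τ y =
      a • WeierstrassCurve.Affine.Point.map (W' := W)
          (RingClassField.inclusion ι
            (ringClassField_mono hK ι hMm' (ne_zero_of_dvd hm'n hn))).toRingHom.toRatAlgHom z -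
        pointGalHom W (ringClassField K ι m') G₁
          (WeierstrassCurve.Affine.Point.map (W' := W)
            (RingClassField.inclusion ι
              (ringClassField_mono hK ι hMm' (ne_zero_of_dvd hm'n hn))).toRingHom.toRatAlgHom z) -
        pointGalHom W (ringClassField K ι m') G₂
          (WeierstrassCurve.Affine.Point.map (W' := W)
            (RingClassField.inclusion ι
              (ringClassField_mono hK ι hMm' (ne_zero_of_dvd hm'n hn))).toRingHom.toRatAlgHom z)) :
    ∃ Γ₁ Γ₂ : ringClassGal ι n,
      ∑ e : ((ringClassGalOver ι n M).subgroupOf (ringClassGal ι n)) ⧸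
          (((ringClassGalOver ι n m').subgroupOf (ringClassGal ι n)).subgroupOf
            ((ringClassGalOver ι n M).subgroupOf (ringClassGal ι n))),
        pointGalHom W (ringClassField K ι n)
          ((e.out : (ringClassGalOver ι n M).subgroupOf (ringClassGal ι n)) : ringClassGal ι n).1
          (WeierstrassCurve.Affine.Point.map (W' := W)
            (RingClassField.inclusion ι (ringClassField_mono hK ι hm'n hn)).toRingHom.toRatAlgHom y) =
      a • WeierstrassCurve.Affine.Point.map (W' := W)
          (RingClassField.inclusion ι
            (ringClassField_mono hK ι (hMm'.trans hm'n) hn)).toRingHom.toRatAlgHom z -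
        pointGalHom W (ringClassField K ι n) Γ₁.1
          (WeierstrassCurve.Affine.Point.map (W' := W)
            (RingClassField.inclusion ι
              (ringClassField_mono hK ι (hMm'.trans hm'n) hn)).toRingHom.toRatAlgHom z) -
        pointGalHom W (ringClassField K ι n) Γ₂.1
          (WeierstrassCurve.Affine.Point.map (W' := W)
            (RingClassField.inclusion ι
              (ringClassField_mono hK ι (hMm'.trans hm'n) hn)).toRingHom.toRatAlgHom z) := by
  obtain ⟨Γ₁, hΓ₁⟩ := exists_restrictGal_eq_of_mem_ringClassGal ι hK hm'n hn G₁ hG₁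
  obtain ⟨Γ₂, hΓ₂⟩ := exists_restrictGal_eq_of_mem_ringClassGal ι hK hm'n hn G₂ hG₂
  refine ⟨Γ₁, Γ₂, ?_⟩
  -- the finite sum over `Gal(K[m']/K[M])` at level `m'`
  have hsum : ∑ τ : ringClassGalOver ι m' M, pointGalHom W (ringClassField K ι m') τ.1 y =
      a • WeierstrassCurve.Affine.Point.map (W' := W)
          (RingClassField.inclusion ι
            (ringClassField_mono hK ι hMm' (ne_zero_of_dvd hm'n hn))).toRingHom.toRatAlgHom z -
        pointGalHom W (ringClassField K ι m') G₁
          (WeierstrassCurve.Affine.Point.map (W' := W)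
            (RingClassField.inclusion ι
              (ringClassField_mono hK ι hMm' (ne_zero_of_dvd hm'n hn))).toRingHom.toRatAlgHom z) -
        pointGalHom W (ringClassField K ι m') G₂
          (WeierstrassCurve.Affine.Point.map (W' := W)
            (RingClassField.inclusion ι
              (ringClassField_mono hK ι hMm' (ne_zero_of_dvd hm'n hn))).toRingHom.toRatAlgHom z) := by
    rw [← hstep, ← finsum_set_coe_eq_finsum_mem, finsum_eq_sum_of_fintype]
    exact Fintype.sum_equiv (Equiv.refl _) _ _ (fun _ => rfl)
  rw [sum_quotient_pointGalHom_map_inclusion ι hK hm'n hn hMm' W y, hsum, map_sub, map_sub, map_zsmul,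
    map_inclusion_map_inclusion ι hK hm'n hn hMm' W z, ← hΓ₁, ← hΓ₂,
    map_inclusion_pointGalHom_restrictGal ι hK hm'n hn W Γ₁,
    map_inclusion_pointGalHom_restrictGal ι hK hm'n hn W Γ₂,
    map_inclusion_map_inclusion ι hK hm'n hn hMm' W z]


/-! ## §3 One level of the tower inside `Gal(K[n]/K)`: the split and the inert folds -/

/-- **SPLIT FOLD over `Gal(K[n]/K)`.** `G = Gal(K[n]/K)`, `H_M = Gal(K[n]/K[M])`, `H = Gal(K[n]/K[m'])`
(`M ∣ m' ∣ n`). If `Σ_{d ∈ G/H_M} d̃ · incl_{M→n}(z) = m · y_K` (the lower levels, `y_K` a `K`-point read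
in `E(K[n])`) and the one-step relation at `K[m']` has Darmon's split shape
`Σ_{τ ∈ Gal(K[m']/K[M])} τ·y = a·incl(z) − G₁ incl(z) − G₂ incl(z)` (`G₁, G₂ ∈ Gal(K[m']/K)`), then
`Σ_{c ∈ G/H} c̃ · incl_{m'→n}(y) = ((a − 2)·m) · y_K`: transitivity of relative traces, the transport
of §2, commutativity of `G` (`Γ c̃ = c̃ Γ`, so the `Γᵢ`-terms are `Γᵢ (m·y_K) = m·y_K` — `K`-points are
fixed). [cite: Darmon2004, Prop. 3.10 (the shape of case (2))] [cite: GrossLMS1991, §3 (𝒢_n abelian)] -/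
theorem sum_quotient_eq_sub_two_mul_smul_of_split_step {M : ℕ} (hMm' : M ∣ m')
    (W : WeierstrassCurve ℚ)
    [Fintype (ringClassGal ι n ⧸ (ringClassGalOver ι n m').subgroupOf (ringClassGal ι n))]
    [Fintype (ringClassGal ι n ⧸ (ringClassGalOver ι n M).subgroupOf (ringClassGal ι n))]
    [Fintype (((ringClassGalOver ι n M).subgroupOf (ringClassGal ι n)) ⧸
      (((ringClassGalOver ι n m').subgroupOf (ringClassGal ι n)).subgroupOf
        ((ringClassGalOver ι n M).subgroupOf (ringClassGal ι n))))]
    [Fintype (ringClassGalOver ι m' M)]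
    (y : (W.baseChange (ringClassField K ι m' : Type)).toAffine.Point)
    (z : (W.baseChange (ringClassField K ι M : Type)).toAffine.Point) (a m : ℤ)
    (G₁ G₂ : ringClassField K ι m' ≃ₐ[ℚ] ringClassField K ι m')
    (hG₁ : G₁ ∈ ringClassGal ι m') (hG₂ : G₂ ∈ ringClassGal ι m')
    (hstep : ∑ᶠ τ ∈ (ringClassGalOver ι m' M :
        Set (ringClassField K ι m' ≃ₐ[ℚ] ringClassField K ι m')),
        pointGalHom W (ringClassField K ι m') τ y =
      a • WeierstrassCurve.Affine.Point.map (W' := W)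
          (RingClassField.inclusion ι
            (ringClassField_mono hK ι hMm' (ne_zero_of_dvd hm'n hn))).toRingHom.toRatAlgHom z -
        pointGalHom W (ringClassField K ι m') G₁
          (WeierstrassCurve.Affine.Point.map (W' := W)
            (RingClassField.inclusion ι
              (ringClassField_mono hK ι hMm' (ne_zero_of_dvd hm'n hn))).toRingHom.toRatAlgHom z) -
        pointGalHom W (ringClassField K ι m') G₂
          (WeierstrassCurve.Affine.Point.map (W' := W)
            (RingClassField.inclusion ι
              (ringClassField_mono hK ι hMm' (ne_zero_of_dvd hm'n hn))).toRingHom.toRatAlgHom z))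
    (yK : (W.baseChange K).toAffine.Point)
    (hIH : ∑ d : ringClassGal ι n ⧸ (ringClassGalOver ι n M).subgroupOf (ringClassGal ι n),
        pointGalHom W (ringClassField K ι n) (d.out : ringClassGal ι n).1
          (WeierstrassCurve.Affine.Point.map (W' := W)
            (RingClassField.inclusion ι
              (ringClassField_mono hK ι (hMm'.trans hm'n) hn)).toRingHom.toRatAlgHom z) =
      m • WeierstrassCurve.Affine.Point.map (W' := W)
        (algebraMap K (ringClassField K ι n)).toRatAlgHom yK) :
    ∑ c : ringClassGal ι n ⧸ (ringClassGalOver ι n m').subgroupOf (ringClassGal ι n),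
        pointGalHom W (ringClassField K ι n) (c.out : ringClassGal ι n).1
          (WeierstrassCurve.Affine.Point.map (W' := W)
            (RingClassField.inclusion ι (ringClassField_mono hK ι hm'n hn)).toRingHom.toRatAlgHom y) =
      ((a - 2) * m) • WeierstrassCurve.Affine.Point.map (W' := W)
        (algebraMap K (ringClassField K ι n)).toRatAlgHom yK := by
  set ρ : ringClassGal ι n →* AddMonoid.End (W.baseChange (ringClassField K ι n : Type)).toAffine.Point :=
    (pointGalHom W (ringClassField K ι n)).comp (ringClassGal ι n).subtype with hρ
  have hle : (ringClassGalOver ι n m').subgroupOf (ringClassGal ι n) ≤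
      (ringClassGalOver ι n M).subgroupOf (ringClassGal ι n) :=
    fun σ hσ => Subgroup.mem_subgroupOf.mpr
      (ringClassGalOver_anti ι hK hm'n hn hMm' (Subgroup.mem_subgroupOf.mp hσ))
  have hfix : ∀ h : (ringClassGalOver ι n m').subgroupOf (ringClassGal ι n), ρ (h : ringClassGal ι n)
      (WeierstrassCurve.Affine.Point.map (W' := W)
        (RingClassField.inclusion ι (ringClassField_mono hK ι hm'n hn)).toRingHom.toRatAlgHom y) =
      WeierstrassCurve.Affine.Point.map (W' := W)
        (RingClassField.inclusion ι (ringClassField_mono hK ι hm'n hn)).toRingHom.toRatAlgHom y :=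
    fun h => pointGalHom_map_inclusion_eq_of_mem ι hK hm'n hn W (Subgroup.mem_subgroupOf.mp h.2) y
  obtain ⟨Γ₁, Γ₂, hrel⟩ := exists_sum_quotient_pointGalHom_eq_sub_sub_of_step ι hK hm'n hn hMm' W y z
    a G₁ G₂ hG₁ hG₂ hstep
  have key := GenusCongruence.sum_quotient_eq_sum_quotient_sum ρ
    ((ringClassGalOver ι n m').subgroupOf (ringClassGal ι n)) hle hfix
  simp only [hρ, MonoidHom.comp_apply, Subgroup.coe_subtype] at key
  rw [key, hrel]
  -- abbreviate the transported point and the `K`-point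
  set P₁ := WeierstrassCurve.Affine.Point.map (W' := W)
    (RingClassField.inclusion ι (ringClassField_mono hK ι (hMm'.trans hm'n) hn)).toRingHom.toRatAlgHom z
    with hP₁
  set Y := WeierstrassCurve.Affine.Point.map (W' := W) (algebraMap K (ringClassField K ι n)).toRatAlgHom yK
    with hY
  -- commutativity of `G`: the `Γ`-terms contribute `m · y_K` each
  have hΓ : ∀ Γ : ringClassGal ι n,
      ∑ d : ringClassGal ι n ⧸ (ringClassGalOver ι n M).subgroupOf (ringClassGal ι n),
        pointGalHom W (ringClassField K ι n) (d.out : ringClassGal ι n).1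
          (pointGalHom W (ringClassField K ι n) Γ.1 P₁) = m • Y := by
    intro Γ
    have hc : ∀ d : ringClassGal ι n ⧸ (ringClassGalOver ι n M).subgroupOf (ringClassGal ι n),
        pointGalHom W (ringClassField K ι n) (d.out : ringClassGal ι n).1
          (pointGalHom W (ringClassField K ι n) Γ.1 P₁) =
        pointGalHom W (ringClassField K ι n) Γ.1
          (pointGalHom W (ringClassField K ι n) (d.out : ringClassGal ι n).1 P₁) := by
      intro d
      rw [← GenusCongruence.map_mul_apply, ← GenusCongruence.map_mul_apply, ← Subgroup.coe_mul,
        ← Subgroup.coe_mul, (KolyvaginH44.isMulCommutative_ringClassGal' hK ι n).is_comm.comm]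
    simp_rw [hc]
    rw [← map_sum, hIH, map_zsmul, pointGalHom_map_eq_of_mem_ringClassGal ι n W Γ.2 yK]
  simp only [map_sub, map_zsmul, Finset.sum_sub_distrib, ← Finset.smul_sum]
  rw [hIH, hΓ Γ₁, hΓ Γ₂, smul_smul, show (a - 2) * m = a * m - m - m by ring, sub_smul, sub_smul]

/-- **INERT FOLD over `Gal(K[n]/K)`.** Same tower; if the one-step relation at `K[m']` has the inert
shape `Σ_{τ ∈ Gal(K[m']/K[M])} τ·y = a·incl(z)` (CLTZ 2015 Lemma 2.9, pulled back to `E(K[m'])`) and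
the lower levels give `Σ_{d ∈ G/H_M} d̃ · incl_{M→n}(z) = m · y_K`, then
`Σ_{c ∈ G/H} c̃ · incl_{m'→n}(y) = (a·m) · y_K` (`sum_quotient_pointGalHom_eq_smul_of_step` +
`GenusCongruence.sum_quotient_eq_smul_of_rel`).
[cite: CoatesLiTianZhai2015, Lemma 2.9 (general fact)] -/
theorem sum_quotient_eq_mul_smul_of_inert_step {M : ℕ} (hMm' : M ∣ m')
    (W : WeierstrassCurve ℚ)
    [Fintype (ringClassGal ι n ⧸ (ringClassGalOver ι n m').subgroupOf (ringClassGal ι n))]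
    [Fintype (ringClassGal ι n ⧸ (ringClassGalOver ι n M).subgroupOf (ringClassGal ι n))]
    [Fintype (((ringClassGalOver ι n M).subgroupOf (ringClassGal ι n)) ⧸
      (((ringClassGalOver ι n m').subgroupOf (ringClassGal ι n)).subgroupOf
        ((ringClassGalOver ι n M).subgroupOf (ringClassGal ι n))))]
    [Fintype (ringClassGalOver ι m' M)]
    (y : (W.baseChange (ringClassField K ι m' : Type)).toAffine.Point)
    (z : (W.baseChange (ringClassField K ι M : Type)).toAffine.Point) (a m : ℤ)
    (hstep : ∑ τ : ringClassGalOver ι m' M, pointGalHom W (ringClassField K ι m') τ.1 y =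
      a • WeierstrassCurve.Affine.Point.map (W' := W)
        (RingClassField.inclusion ι
          (ringClassField_mono hK ι hMm' (ne_zero_of_dvd hm'n hn))).toRingHom.toRatAlgHom z)
    (yK : (W.baseChange K).toAffine.Point)
    (hIH : ∑ d : ringClassGal ι n ⧸ (ringClassGalOver ι n M).subgroupOf (ringClassGal ι n),
        pointGalHom W (ringClassField K ι n) (d.out : ringClassGal ι n).1
          (WeierstrassCurve.Affine.Point.map (W' := W)
            (RingClassField.inclusion ι
              (ringClassField_mono hK ι (hMm'.trans hm'n) hn)).toRingHom.toRatAlgHom z) =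
      m • WeierstrassCurve.Affine.Point.map (W' := W)
        (algebraMap K (ringClassField K ι n)).toRatAlgHom yK) :
    ∑ c : ringClassGal ι n ⧸ (ringClassGalOver ι n m').subgroupOf (ringClassGal ι n),
        pointGalHom W (ringClassField K ι n) (c.out : ringClassGal ι n).1
          (WeierstrassCurve.Affine.Point.map (W' := W)
            (RingClassField.inclusion ι (ringClassField_mono hK ι hm'n hn)).toRingHom.toRatAlgHom y) =
      (a * m) • WeierstrassCurve.Affine.Point.map (W' := W)
        (algebraMap K (ringClassField K ι n)).toRatAlgHom yK := by
  set ρ : ringClassGal ι n →* AddMonoid.End (W.baseChange (ringClassField K ι n : Type)).toAffine.Point :=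
    (pointGalHom W (ringClassField K ι n)).comp (ringClassGal ι n).subtype with hρ
  have hle : (ringClassGalOver ι n m').subgroupOf (ringClassGal ι n) ≤
      (ringClassGalOver ι n M).subgroupOf (ringClassGal ι n) :=
    fun σ hσ => Subgroup.mem_subgroupOf.mpr
      (ringClassGalOver_anti ι hK hm'n hn hMm' (Subgroup.mem_subgroupOf.mp hσ))
  have hfix : ∀ h : (ringClassGalOver ι n m').subgroupOf (ringClassGal ι n), ρ (h : ringClassGal ι n)
      (WeierstrassCurve.Affine.Point.map (W' := W)
        (RingClassField.inclusion ι (ringClassField_mono hK ι hm'n hn)).toRingHom.toRatAlgHom y) =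
      WeierstrassCurve.Affine.Point.map (W' := W)
        (RingClassField.inclusion ι (ringClassField_mono hK ι hm'n hn)).toRingHom.toRatAlgHom y :=
    fun h => pointGalHom_map_inclusion_eq_of_mem ι hK hm'n hn W (Subgroup.mem_subgroupOf.mp h.2) y
  have hrel := sum_quotient_pointGalHom_eq_smul_of_step ι hK hm'n hn hMm' W y z a hstep
  have hrel' : ∑ e : ((ringClassGalOver ι n M).subgroupOf (ringClassGal ι n)) ⧸
      (((ringClassGalOver ι n m').subgroupOf (ringClassGal ι n)).subgroupOf
        ((ringClassGalOver ι n M).subgroupOf (ringClassGal ι n))),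
      ρ ((e.out : (ringClassGalOver ι n M).subgroupOf (ringClassGal ι n)) : ringClassGal ι n)
        (WeierstrassCurve.Affine.Point.map (W' := W)
          (RingClassField.inclusion ι (ringClassField_mono hK ι hm'n hn)).toRingHom.toRatAlgHom y) =
      a • WeierstrassCurve.Affine.Point.map (W' := W)
        (RingClassField.inclusion ι
          (ringClassField_mono hK ι (hMm'.trans hm'n) hn)).toRingHom.toRatAlgHom z := by
    simpa only [hρ, MonoidHom.comp_apply, Subgroup.coe_subtype] using hrel
  have key := GenusCongruence.sum_quotient_eq_smul_of_rel ρ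
    ((ringClassGalOver ι n m').subgroupOf (ringClassGal ι n)) hle hfix hrel'
  simp only [hρ, MonoidHom.comp_apply, Subgroup.coe_subtype] at key
  rw [key, hIH, smul_smul]



end Summit.BirchSwinnertonDyer.Uniform.U2.RingClass

end
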